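import Summits.RiemannHypothesis.RiemannHypothesis.Theorems.WindowTraceArch.Negative.LocalWeylTools
import Literature.NumberTheory.LFunctions.WeilExplicitProofs
import Literature.NumberTheory.LFunctions.WeilMellinBounds
import HarnessLib

/-!
# `SpectralIsHpSpectrum` — two real spectra of one functional have the same multiplicities

Helper file for the crux `stmt-RiemannHypothesis-0195`
(`Summit.RiemannHypothesis.RiemannHypothesis.Theses.SpectralTrace.SpectralIsHpSpectrum`), line
`self-majorant-peak` (crux-ideate ideator 2, gen 2; kernel-checked evidence
`Cruxes/SpectralIsHpSpectrum/SelfMajorantComplete.lean`, landed here by the line lead).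

Everything is W-FREE: `γ : ι → ℝ` is a real spectrum of an ARBITRARY functional
`L : (ℝ → ℂ) → ℂ` on the Weil tests, i.e. `HasSum (i ↦ ĝ(1/2 + iγ_i)) (L g)` for every Weil
test `g` (`ĝ = weilMellin g`). No positivity, no local Weyl law, no value of `L` is used.

* `summable_norm_of_trace` — THE LEVER: `HasSum` in `ℂ` is unconditional, hence absolute,
  convergence (`summable_norm_iff`), so the hypothesis at `g` is its own Tannery majorant.
* `finite_fibre_of_trace` — every fibre `{i | γ_i = x}` is finite (a summable family tends to `0`
  along `cofinite`, and `exists_isWeilTest_re_weilMellin_pos x` gives a test with `ĝ(1/2+ix) ≠ 0`).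
* `isWeilTest_dilate`, `weilMellin_dilate` — dilation `t ↦ R⁻¹ p(t/R)` and
  `(D_R p)^(s) = p̂(1/2 + R(s − 1/2))`.
* `exists_peak_sequence` — for every `x` a sequence of Weil tests `q_n` (modulated dilations
  `e^{-ixt} (n+1)⁻¹ p(t/(n+1))`) with `‖q̂_n‖ ≤ C` on the critical line and
  `q̂_n(1/2+iu) → c·𝟙[u = x]`, `c ≠ 0`.
* `tendsto_trace_weilConv_peak` — self-majorised Tannery limit:
  `L(g ⋆ q_n) → #{i | γ_i = x} · c · ĝ(1/2+ix)`.
* `ncard_fibre_eq_of_trace`, `encard_fibre_eq_of_trace` — two real spectra of the same `L` have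
  the same fibre counts (uniqueness of limits in `ℂ`); `stub_encardFibreEq` is the verbatim
  registered stub of the lead's skeleton `Cruxes/SpectralIsHpSpectrum/Lines/self-majorant-peak.lean`.

References: Tannery's theorem (`tendsto_tsum_of_dominated_convergence`); the convolution theorem
`weilMellin_weilConv_holds` (Bombieri 2000, §2) and the bump `exists_isWeilTest_re_weilMellin_pos`
of the tree's Weil toolkit.
-/

noncomputable section

open Complex Set MeasureTheory Filter
open scoped Topology

namespace Summit.RiemannHypothesis.RiemannHypothesis.Theorems.SpectralIsHpSpectrum

open Literature.NumberTheory.LFunctions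
open Summit.RiemannHypothesis.RiemannHypothesis.Theorems.WindowTraceArch.Negative

/-! ### The lever: a real spectrum is absolutely summable; fibres are finite -/

/-- **The lever.** A real spectrum of any functional `L` is absolutely summable against every
Weil test: `HasSum` in the finite-dimensional space `ℂ` is unconditional, hence absolute,
convergence (`summable_norm_iff`). [folklore] -/
theorem summable_norm_of_trace {ι : Type*} {γ : ι → ℝ} {L : (ℝ → ℂ) → ℂ}
    (hγ : ∀ g : ℝ → ℂ, IsWeilTest g →
      HasSum (fun i => weilMellin g (1 / 2 + (γ i : ℂ) * I)) (L g))
    {g : ℝ → ℂ} (hg : IsWeilTest g) :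
    Summable fun i => ‖weilMellin g (1 / 2 + (γ i : ℂ) * I)‖ :=
  summable_norm_iff.mpr (hγ g hg).summable

/-- **Charged fibres are finite**: if `ĝ(1/2 + ix) ≠ 0` for some Weil test `g`, the fibre of a
real spectrum over `x` is finite (on the fibre the terms all equal `ĝ(1/2+ix) ≠ 0`, while a
summable family tends to `0` along the cofinite filter). [folklore] -/
theorem finite_fibre_of_weilMellin_ne_zero {ι : Type*} {γ : ι → ℝ} {L : (ℝ → ℂ) → ℂ}
    (hγ : ∀ g : ℝ → ℂ, IsWeilTest g →
      HasSum (fun i => weilMellin g (1 / 2 + (γ i : ℂ) * I)) (L g))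
    {g : ℝ → ℂ} (hg : IsWeilTest g) {x : ℝ} (hx : weilMellin g (1 / 2 + x * I) ≠ 0) :
    {i | γ i = x}.Finite := by
  have h0 := (summable_norm_of_trace hγ hg).tendsto_cofinite_zero
  have hε : (0 : ℝ) < ‖weilMellin g (1 / 2 + x * I)‖ := norm_pos_iff.mpr hx
  have hev : ∀ᶠ i in cofinite, ‖weilMellin g (1 / 2 + (γ i : ℂ) * I)‖ <
      ‖weilMellin g (1 / 2 + x * I)‖ := h0.eventually (gt_mem_nhds hε)
  rw [Filter.eventually_cofinite] at hev
  refine hev.subset fun i hi => ?_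
  simp only [Set.mem_setOf_eq] at hi ⊢
  rw [hi]
  exact lt_irrefl _

/-- The narrow bump of `exists_isWeilTest_re_weilMellin_pos x` does not vanish at `1/2 + ix`.
[folklore] -/
theorem exists_isWeilTest_weilMellin_ne_zero (x : ℝ) :
    ∃ g : ℝ → ℂ, IsWeilTest g ∧ weilMellin g (1 / 2 + x * I) ≠ 0 := by
  obtain ⟨g, hg, hpos⟩ := exists_isWeilTest_re_weilMellin_pos x
  refine ⟨g, hg, fun h0 => ?_⟩
  have h1 := hpos (1 / 2)
  have h2 : ((1 / 2 : ℝ) : ℂ) + x * I = 1 / 2 + x * I := by push_cast; ring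
  rw [h2, h0] at h1
  simp at h1

/-- **Every fibre of a real spectrum is finite** — without any counting law. [folklore] -/
theorem finite_fibre_of_trace {ι : Type*} {γ : ι → ℝ} {L : (ℝ → ℂ) → ℂ}
    (hγ : ∀ g : ℝ → ℂ, IsWeilTest g →
      HasSum (fun i => weilMellin g (1 / 2 + (γ i : ℂ) * I)) (L g))
    (x : ℝ) : {i | γ i = x}.Finite := by
  obtain ⟨g, hg, hx⟩ := exists_isWeilTest_weilMellin_ne_zero x
  exact finite_fibre_of_weilMellin_ne_zero hγ hg hx

/-! ### Dilations and the peak sequence -/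

/-- Dilations `t ↦ R⁻¹ p(t/R)` (`R > 0`) of Weil tests are Weil tests. [folklore] -/
theorem isWeilTest_dilate {p : ℝ → ℂ} (hp : IsWeilTest p) {R : ℝ} (hR : 0 < R) :
    IsWeilTest fun t : ℝ => ((R : ℝ) : ℂ)⁻¹ * p (t / R) := by
  refine ⟨contDiff_const.mul (hp.1.comp (contDiff_id.div_const R)), ?_⟩
  have e : (fun t : ℝ => p (t / R)) = p ∘ (Homeomorph.mulRight₀ R⁻¹ (inv_ne_zero hR.ne')) := by
    ext t
    simp [div_eq_mul_inv]
  have h2 : HasCompactSupport fun t : ℝ => p (t / R) := by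
    rw [e]
    exact hp.2.comp_homeomorph _
  exact h2.mul_left

/-- **Dilation substitution**: `(D_R p)^(s) = p̂(1/2 + R (s − 1/2))` for `D_R p = R⁻¹ p(·/R)`,
i.e. on the critical line `(D_R p)^(1/2 + iu) = p̂(1/2 + iRu)` (`t = R y`,
`MeasureTheory.Measure.integral_comp_div`). [folklore] -/
theorem weilMellin_dilate (p : ℝ → ℂ) {R : ℝ} (hR : 0 < R) (s : ℂ) :
    weilMellin (fun t : ℝ => ((R : ℝ) : ℂ)⁻¹ * p (t / R)) s =
      weilMellin p (1 / 2 + R * (s - 1 / 2)) := by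
  unfold weilMellin
  set G : ℝ → ℂ := fun y => ((R : ℝ) : ℂ)⁻¹ * p y * cexp ((s - 1 / 2) * (R : ℂ) * (y : ℂ))
    with hG
  have hRC : ((R : ℝ) : ℂ) ≠ 0 := Complex.ofReal_ne_zero.mpr hR.ne'
  have h1 : (fun t : ℝ => ((R : ℝ) : ℂ)⁻¹ * p (t / R) * cexp ((s - 1 / 2) * (t : ℂ))) =
      fun t : ℝ => G (t / R) := by
    ext t
    simp only [hG]
    congr 2
    push_cast
    field_simp
  have h2 : (fun t : ℝ => p t * cexp ((1 / 2 + (R : ℂ) * (s - 1 / 2) - 1 / 2) * (t : ℂ))) =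
      fun t : ℝ => ((R : ℝ) : ℂ) * G t := by
    ext t
    simp only [hG]
    have e : (1 / 2 + (R : ℂ) * (s - 1 / 2) - 1 / 2) * (t : ℂ) = (s - 1 / 2) * (R : ℂ) * (t : ℂ) := by
      ring
    rw [e]
    field_simp
  rw [h1, h2, MeasureTheory.Measure.integral_comp_div G R, abs_of_pos hR, integral_const_mul,
    Complex.real_smul]

/-- Spectral side of the modulated dilation `t ↦ e^{-ixt} R⁻¹ p(t/R)`:
`p̂(1/2 + iR(u − x))` (`weilMellin_modulate` + `weilMellin_dilate`). [folklore] -/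
theorem weilMellin_modulate_dilate (p : ℝ → ℂ) {R : ℝ} (hR : 0 < R) (x u : ℝ) :
    weilMellin (fun t : ℝ => cexp (-((x * t : ℝ) : ℂ) * I) * (((R : ℝ) : ℂ)⁻¹ * p (t / R)))
      (1 / 2 + u * I) = weilMellin p (1 / 2 + ((R * (u - x) : ℝ) : ℂ) * I) := by
  rw [weilMellin_modulate (fun t : ℝ => ((R : ℝ) : ℂ)⁻¹ * p (t / R)) x u, weilMellin_dilate p hR]
  congr 1
  push_cast
  ring

/-- **The peak sequence.** For every real `x` there are Weil tests `q_n` whose transforms are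
uniformly bounded on the critical line and converge pointwise to `c · 𝟙[u = x]` with `c ≠ 0`:
take `q_n(t) = e^{-ixt} (n+1)⁻¹ p(t/(n+1))` for a bump `p` with `p̂(1/2) ≠ 0`; then
`q̂_n(1/2+iu) = p̂(1/2 + i(n+1)(u−x))`, bounded by `‖p‖_{L¹(e^{|t|/2})}`
(`norm_weilMellin_le_weilL1`) and tending to `0` off `u = x` by the decay
`‖p̂(1/2+iv)‖ ≤ C_p/(1+v²)` (`norm_weilMellin_le`). [folklore] -/
theorem exists_peak_sequence (x : ℝ) :
    ∃ q : ℕ → ℝ → ℂ, (∀ n, IsWeilTest (q n)) ∧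
      (∃ C : ℝ, ∀ (n : ℕ) (u : ℝ), ‖weilMellin (q n) (1 / 2 + u * I)‖ ≤ C) ∧
      ∃ c : ℂ, c ≠ 0 ∧ ∀ u : ℝ,
        Tendsto (fun n : ℕ => weilMellin (q n) (1 / 2 + u * I)) atTop
          (𝓝 (if u = x then c else 0)) := by
  obtain ⟨p, hp, hp0⟩ := exists_isWeilTest_weilMellin_ne_zero 0
  have hp0' : weilMellin p (1 / 2) ≠ 0 := by simpa using hp0
  refine ⟨fun n t => cexp (-((x * t : ℝ) : ℂ) * I) *
      (((((n : ℝ) + 1 : ℝ)) : ℂ)⁻¹ * p (t / ((n : ℝ) + 1))), fun n => ?_, ⟨weilL1 p, fun n u => ?_⟩,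
    weilMellin p (1 / 2), hp0', fun u => ?_⟩
  · exact isWeilTest_modulate (isWeilTest_dilate hp (by positivity)) x
  · rw [weilMellin_modulate_dilate p (by positivity)]
    exact norm_weilMellin_le_weilL1 hp.1.continuous hp.2 (by simp) (by norm_num)
  · have hfun : (fun n : ℕ => weilMellin (fun t : ℝ => cexp (-((x * t : ℝ) : ℂ) * I) *
        (((((n : ℝ) + 1 : ℝ)) : ℂ)⁻¹ * p (t / ((n : ℝ) + 1)))) (1 / 2 + u * I)) =
        fun n : ℕ => weilMellin p (1 / 2 + ((((n : ℝ) + 1) * (u - x) : ℝ) : ℂ) * I) :=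
      funext fun n => weilMellin_modulate_dilate p (by positivity) x u
    rw [hfun]
    by_cases hu : u = x
    · subst hu
      simp only [sub_self, mul_zero, Complex.ofReal_zero, zero_mul, add_zero, if_true]
      exact tendsto_const_nhds
    · rw [if_neg hu]
      have hux : 0 < (u - x) ^ 2 := by
        have : u - x ≠ 0 := sub_ne_zero.mpr hu
        positivity
      have him : ∀ v : ℝ, ((1 / 2 : ℂ) + (v : ℂ) * I).im = v := fun v => by simp
      have hbound : ∀ n : ℕ, ‖weilMellin p (1 / 2 + ((((n : ℝ) + 1) * (u - x) : ℝ) : ℂ) * I)‖ ≤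
          weilDecayConst p / (1 + (((n : ℝ) + 1) * (u - x)) ^ 2) := by
        intro n
        have h := norm_weilMellin_le hp (s := 1 / 2 + ((((n : ℝ) + 1) * (u - x) : ℝ) : ℂ) * I)
          (by simp) (by norm_num)
        rwa [him] at h
      have hden : Tendsto (fun n : ℕ => 1 + (((n : ℝ) + 1) * (u - x)) ^ 2) atTop atTop := by
        have h1 : Tendsto (fun n : ℕ => ((n : ℝ) + 1)) atTop atTop :=
          tendsto_atTop_add_const_right _ 1 tendsto_natCast_atTop_atTop
        have h2 : Tendsto (fun n : ℕ => ((n : ℝ) + 1) ^ 2) atTop atTop :=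
          (tendsto_pow_atTop two_ne_zero).comp h1
        have h3 : Tendsto (fun n : ℕ => (u - x) ^ 2 * ((n : ℝ) + 1) ^ 2) atTop atTop :=
          h2.const_mul_atTop hux
        have h4 : Tendsto (fun n : ℕ => 1 + (u - x) ^ 2 * ((n : ℝ) + 1) ^ 2) atTop atTop :=
          tendsto_atTop_add_const_left _ 1 h3
        refine h4.congr fun n => ?_
        ring
      have hlim : Tendsto (fun n : ℕ => weilDecayConst p / (1 + (((n : ℝ) + 1) * (u - x)) ^ 2))
          atTop (𝓝 0) := tendsto_const_nhds.div_atTop hden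
      exact squeeze_zero_norm hbound hlim

/-! ### The self-majorised Tannery limit and uniqueness of multiplicities -/

/-- **Self-majorised Tannery limit.** Let `γ` be a real spectrum of `L`, `g` a Weil test, and
`q_n` Weil tests with `‖q̂_n(1/2+iu)‖ ≤ C` and `q̂_n(1/2+iu) → c·𝟙[u = x]`. Then
`L(g ⋆ q_n) → #{i | γ_i = x} · (c · ĝ(1/2+ix))`.
Proof: `L(g ⋆ q_n) = Σ_i ĝ(1/2+iγ_i) q̂_n(1/2+iγ_i)` (hypothesis at the Weil test `g ⋆ q_n`,
`weilMellin_weilConv_holds`); Tannery (`tendsto_tsum_of_dominated_convergence`) with the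
majorant `i ↦ C‖ĝ(1/2+iγ_i)‖`, summable by `summable_norm_of_trace`; the limit family is
supported on the finite fibre (`finite_fibre_of_trace`), where it is constant. [folklore] -/
theorem tendsto_trace_weilConv_peak {ι : Type*} {γ : ι → ℝ} {L : (ℝ → ℂ) → ℂ}
    (hγ : ∀ g : ℝ → ℂ, IsWeilTest g →
      HasSum (fun i => weilMellin g (1 / 2 + (γ i : ℂ) * I)) (L g))
    {g : ℝ → ℂ} (hg : IsWeilTest g) {q : ℕ → ℝ → ℂ} (hq : ∀ n, IsWeilTest (q n)) {C : ℝ}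
    (hC : ∀ (n : ℕ) (u : ℝ), ‖weilMellin (q n) (1 / 2 + u * I)‖ ≤ C) {x : ℝ} {c : ℂ}
    (hlim : ∀ u : ℝ, Tendsto (fun n : ℕ => weilMellin (q n) (1 / 2 + u * I)) atTop
      (𝓝 (if u = x then c else 0))) :
    Tendsto (fun n : ℕ => L (weilConv g (q n))) atTop
      (𝓝 ((({i | γ i = x}.ncard : ℕ) : ℂ) * (c * weilMellin g (1 / 2 + x * I)))) := by
  have hF : {i | γ i = x}.Finite := finite_fibre_of_trace hγ x
  set f : ℕ → ι → ℂ := fun n i =>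
    weilMellin g (1 / 2 + (γ i : ℂ) * I) * weilMellin (q n) (1 / 2 + (γ i : ℂ) * I) with hf
  set c' : ℂ := c * weilMellin g (1 / 2 + x * I) with hc'
  set glim : ι → ℂ := fun i => if γ i = x then c' else 0 with hglim
  -- (1) the majorant is the hypothesis itself
  have hbound : Summable fun i => C * ‖weilMellin g (1 / 2 + (γ i : ℂ) * I)‖ :=
    (summable_norm_of_trace hγ hg).mul_left _
  have hdom : ∀ᶠ n in atTop, ∀ i, ‖f n i‖ ≤ C * ‖weilMellin g (1 / 2 + (γ i : ℂ) * I)‖ :=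
    Eventually.of_forall fun n i => by
      simp only [hf, norm_mul]
      rw [mul_comm]
      exact mul_le_mul_of_nonneg_right (hC n (γ i)) (norm_nonneg _)
  -- (2) pointwise limits: `c'` on the fibre, `0` off it
  have hptw : ∀ i, Tendsto (fun n => f n i) atTop (𝓝 (glim i)) := by
    intro i
    have h := (hlim (γ i)).const_mul (weilMellin g (1 / 2 + (γ i : ℂ) * I))
    have e : glim i = weilMellin g (1 / 2 + (γ i : ℂ) * I) * (if γ i = x then c else 0) := by
      by_cases hi : γ i = x
      · simp only [hglim, if_pos hi]
        rw [hc', hi]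
        ring
      · simp only [hglim, if_neg hi, mul_zero]
    rw [e]
    exact h
  -- (3) Tannery
  have hT := tendsto_tsum_of_dominated_convergence hbound hptw hdom
  -- (4) the limit family sums to `ncard • c'`
  have hzero : ∀ i ∉ hF.toFinset, glim i = 0 := fun i hi => by
    have hi' : ¬ γ i = x := by simpa using hi
    simp only [hglim, if_neg hi']
  have hterm : ∀ i ∈ hF.toFinset, glim i = c' := fun i hi => by
    have hi' : γ i = x := by simpa using hi
    simp only [hglim, if_pos hi']
  have hsum : ∑' i, glim i = (({i | γ i = x}.ncard : ℕ) : ℂ) * c' := by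
    rw [tsum_eq_sum hzero, Finset.sum_congr rfl hterm, Finset.sum_const, nsmul_eq_mul,
      Set.ncard_eq_toFinset_card _ hF]
  -- (5) the trace values are the partial objects of Tannery
  have hval : ∀ n : ℕ, L (weilConv g (q n)) = ∑' i, f n i := fun n => by
    rw [← (hγ _ (hg.weilConv (hq n))).tsum_eq]
    exact tsum_congr fun i =>
      weilMellin_weilConv_holds hg.1.continuous hg.2 (hq n).1.continuous (hq n).2 _
  have hfun : (fun n : ℕ => L (weilConv g (q n))) = fun n => ∑' i, f n i := funext hval
  rw [hfun, ← hsum]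
  exact hT

/-- **Two real spectra of the same functional have the same multiplicities.** Both compute the
SAME sequence `n ↦ L(g ⋆ q_n)`; uniqueness of limits in `ℂ` (`tendsto_nhds_unique`) with `g`
chosen so that `ĝ(1/2+ix) ≠ 0` and the peak constant `c ≠ 0` cancels everything but the fibre
counts (finite on both sides by `finite_fibre_of_trace`). [folklore] -/
theorem ncard_fibre_eq_of_trace {ι ι' : Type*} {γ : ι → ℝ} {γ' : ι' → ℝ} {L : (ℝ → ℂ) → ℂ}
    (hγ : ∀ g : ℝ → ℂ, IsWeilTest g →
      HasSum (fun i => weilMellin g (1 / 2 + (γ i : ℂ) * I)) (L g))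
    (hγ' : ∀ g : ℝ → ℂ, IsWeilTest g →
      HasSum (fun j => weilMellin g (1 / 2 + (γ' j : ℂ) * I)) (L g))
    (x : ℝ) : {i | γ i = x}.ncard = {j | γ' j = x}.ncard := by
  obtain ⟨g, hg, hgx⟩ := exists_isWeilTest_weilMellin_ne_zero x
  obtain ⟨q, hq, ⟨C, hC⟩, c, hc, hlim⟩ := exists_peak_sequence x
  have h1 := tendsto_trace_weilConv_peak hγ hg hq hC hlim
  have h2 := tendsto_trace_weilConv_peak hγ' hg hq hC hlim
  have h3 := tendsto_nhds_unique h1 h2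
  have h4 := mul_right_cancel₀ (mul_ne_zero hc hgx) h3
  exact_mod_cast h4

/-- `encard` form of `ncard_fibre_eq_of_trace` (both fibres are finite). [folklore] -/
theorem encard_fibre_eq_of_trace {ι ι' : Type*} {γ : ι → ℝ} {γ' : ι' → ℝ} {L : (ℝ → ℂ) → ℂ}
    (hγ : ∀ g : ℝ → ℂ, IsWeilTest g →
      HasSum (fun i => weilMellin g (1 / 2 + (γ i : ℂ) * I)) (L g))
    (hγ' : ∀ g : ℝ → ℂ, IsWeilTest g →
      HasSum (fun j => weilMellin g (1 / 2 + (γ' j : ℂ) * I)) (L g))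
    (x : ℝ) : {i | γ i = x}.encard = {j | γ' j = x}.encard := by
  rw [← (finite_fibre_of_trace hγ x).cast_ncard_eq, ← (finite_fibre_of_trace hγ' x).cast_ncard_eq,
    ncard_fibre_eq_of_trace hγ hγ' x]

/-! ### The registered stub of the lead's skeleton (`Cruxes/SpectralIsHpSpectrum/Lines/self-majorant-peak.lean`) -/

/-- **STUB 1 of the line `self-majorant-peak` (`stub_encardFibreEq`, registered on
stmt-RiemannHypothesis-0195), verbatim**: two real spectra of one functional on the Weil tests
have equal fibre `encard`s — `encard_fibre_eq_of_trace` with the binders made explicit.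
[folklore] -/
theorem stub_encardFibreEq :
    ∀ (ι ι' : Type) (γ : ι → ℝ) (γ' : ι' → ℝ) (L : (ℝ → ℂ) → ℂ),
      (∀ g : ℝ → ℂ, IsWeilTest g →
        HasSum (fun i => weilMellin g (1 / 2 + (γ i : ℂ) * I)) (L g)) →
      (∀ g : ℝ → ℂ, IsWeilTest g →
        HasSum (fun j => weilMellin g (1 / 2 + (γ' j : ℂ) * I)) (L g)) →
      ∀ x : ℝ, {i | γ i = x}.encard = {j | γ' j = x}.encard :=
  fun _ _ _ _ _ hγ hγ' x => encard_fibre_eq_of_trace hγ hγ' x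

end Summit.RiemannHypothesis.RiemannHypothesis.Theorems.SpectralIsHpSpectrum

end
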